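import Summits.Ventures.CertifiedArithmetic.LowPrec.EmbeddingDecision
import Summits.Ventures.CertifiedArithmetic.LowPrec.RoundToOdd

/-!
# Theorem D for round trips: when does `X → Y → X` return every value of `X`?

HONEST FRAMING (venture CertifiedArithmetic / cell `pub-lowprec`): certified error envelopes and
provably optimal rounding/accumulation schemes for low-precision formats under stated cost models;
every table by two implementations; no hardware or vendor claims.

`EmbeddingDecision.lean` decides when the conversion `X → Y` is exact on every input
(`F_X ⊆ F_Y`). This file decides the weaker storage property ROUND TRIP: every finite value of
`X`, converted to `Y` and back — both conversions the cell's SATURATING round-to-nearest-even —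
is recovered: `RoundTrips X Y := ∀ x, fl_X (fl_Y x) = x` (as values).

THEOREM D-rt (`roundTrips_iff_test`). Let `Y` have precision `≥ 2` and let `X` contain the power
of two `2^(P_X) · 2^(L_X)` above its first full binade (`2^(m_X+1) ≤ maxScaled_X`; every named
format has dozens of binades). Then `RoundTrips X Y` iff
  (P) `P_X ≤ P_Y`, (Q) `L_Y ≤ L_X`, and (R') `fl_X (M_Y) = M_X` (i.e. `M_X ≤ fl_X (M_Y)`),
one evaluation of the Boolean `roundTripTest`. Compare the embedding test (P), (Q),
(R) `M_X ≤ M_Y`: (R) implies (R') by saturation, and (R') without (R) is the PHANTOM TOP — the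
largest value of `X` is absent from `Y` but `M_Y` rounds back up to it; then `X → Y → X` is
lossless although `X → Y` is not exact (kernel example `phantom_roundTrips_not_embeds` on two
ad-hoc formats). Sufficiency: values of modulus `≤ M_Y` are values of `Y` under (P), (Q)
(`exists_toRat_eq_of_abs_le`), hence fixed twice; a value above `M_Y` is forced to be `±M_X` by
(R') and the nearest property, and goes `M_X ↦ M_Y ↦ M_X`. NECESSITY by three round trips that
fail: (Q) the quantum `2^(L_X)` goes to `0` in `Y` (it is below half the quantum of `Y`, or AT
half of it and the tie goes to the even significand `0` — `roundNE_man_even_of_tie` against the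
parity alternation `not_two_dvd_man_and_succ` of `RoundToOdd.lean`), and `0` comes back as `0`;
(P) given (Q), the value `a = (2^m_X + 1) · 2^(L_X)` (smallest normal significand plus one ulp,
`P_X` significant bits) goes to `B = 2^m_X · 2^(L_X)` in `Y` (the spacing of `Y` at `B` is
`≥ 2 ulp_X`, so `B` is the unique nearest value or, when `P_Y = P_X - 1`, the even side of a tie),
and `B`, a value of `X`, comes back as `B ≠ a` — unless `B > M_Y`, when the top value of `X`
goes to `M_Y < B` and comes back `≤ B < M_X`; (R') is the round trip of the top value itself.

COROLLARIES. `roundTrips_of_embeds` (every pair); for the 13 named records the two tests agree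
on all `169` ordered pairs (`roundTripTest_eq_embedsTest_named`, `decide`: no named pair has a
phantom top), so `roundTrips_named_iff` / `roundTrips_named_iff_embeds`: `X → Y → X` is lossless
iff `F_X ⊆ F_Y` iff `(X, Y) ∈ embedPairs` (67 of 169; `CONVERSION-LATTICE.md`). Reading:
bfloat16 data do not survive a trip through binary16 nor conversely; e4m3 data survive binary16,
bfloat16, binary32 but not fnuz_e4m3 (`448 ↦ 240 ↦ 240`); e5m2 data survive fnuz_e5m2.

TWO IMPLEMENTATIONS: A = `code/enum/roundtrip_decision.py` (brute force `fl_X(fl_Y(x)) = x`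
over the certified value sets for every source of at most 16 bits, the test for all pairs, and
the phantom example); B = this file (kernel). No novelty is claimed for the sufficiency half
[IEEE7542019, §5.4.2: conversions to wider formats are exact]; the necessity half with its
phantom-top clause for saturating finite-domain formats and the named lattice are certified here.
-/

namespace Summit.Ventures.CertifiedArithmetic

open Literature.ComputerArithmetic.FloatingPoint
open Literature.ComputerArithmetic.FloatingPoint.Format
open Literature.ComputerArithmetic.FloatingPoint.MiniFloat

/-- ROUND TRIP `X → Y → X` (both conversions saturating round-to-nearest-even) returns every
finite value of `X`. -/
def RoundTrips (φ ψ : Format) : Prop :=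
  ∀ x : MiniFloat φ, (roundNE φ (roundNE ψ x.toRat).toRat).toRat = x.toRat

/-- THEOREM D-rt, the test: `P_X ≤ P_Y ∧ L_Y ≤ L_X ∧ M_X ≤ fl_X(M_Y)`. -/
def roundTripTest (φ ψ : Format) : Bool :=
  decide (φ.manBits ≤ ψ.manBits) && decide (ψ.qexp ≤ φ.qexp) &&
    decide (φ.maxRat ≤ (roundNE φ ψ.maxRat).toRat)

/-! ## §1 Sufficiency -/

/-- Pointwise embedding below the range of `Y`: under (P) and (Q) every value of `X` of modulus
`≤ M_Y` is a value of `Y`. [cite: IEEE7542019, §5.4.2] -/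
theorem exists_toRat_eq_of_abs_le {φ ψ : Format} (hm : φ.manBits ≤ ψ.manBits)
    (hq : ψ.qexp ≤ φ.qexp) (x : MiniFloat φ) (hx : |x.toRat| ≤ ψ.maxRat) :
    ∃ z : MiniFloat ψ, z.toRat = x.toRat := by
  obtain ⟨M, e, hM, he, hxe⟩ := isFloat_toRat x
  refine exists_toRat_eq_of_isFloat ⟨M, e, lt_of_lt_of_le hM ?_, le_trans hq he, hxe⟩ hx
  exact_mod_cast Nat.pow_le_pow_right (by norm_num) (by omega)

/-- SUFFICIENCY: a passing test round-trips (every pair of formats). -/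
theorem roundTrips_of_test {φ ψ : Format} (ht : roundTripTest φ ψ = true) : RoundTrips φ ψ := by
  simp only [roundTripTest, Bool.and_eq_true, decide_eq_true_eq] at ht
  obtain ⟨⟨hm, hq⟩, hM⟩ := ht
  have htop : (roundNE φ ψ.maxRat).toRat = φ.maxRat :=
    le_antisymm (le_trans (le_abs_self _) (abs_toRat_le_maxRat _)) hM
  intro x
  by_cases hx : |x.toRat| ≤ ψ.maxRat
  · rw [toRat_roundNE_of_exists (exists_toRat_eq_of_abs_le hm hq x hx), toRat_roundNE_toRat]
  · push Not at hx
    obtain ⟨y, hy⟩ : ∃ y : MiniFloat φ, y.toRat = |x.toRat| := by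
      rcases le_or_gt 0 x.toRat with h | h
      · exact ⟨x, (abs_of_nonneg h).symm⟩
      · exact ⟨x.flipSign, by rw [toRat_flipSign, abs_of_neg h]⟩
    have hnear := roundNE_nearest (φ := φ) ψ.maxRat y
    rw [htop, hy] at hnear
    have hxle : |x.toRat| ≤ φ.maxRat := abs_toRat_le_maxRat x
    have hlt : ψ.maxRat < φ.maxRat := lt_of_lt_of_le hx hxle
    rw [abs_of_nonpos (by linarith), abs_of_nonpos (by linarith)] at hnear
    have habs : |x.toRat| = φ.maxRat := by linarith
    rcases le_or_gt 0 x.toRat with h | h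
    · rw [abs_of_nonneg h] at habs
      rw [habs, toRat_roundNE_of_maxRat_le_pos hlt.le, htop]
    · rw [abs_of_neg h] at habs
      have hx' : x.toRat = -φ.maxRat := by linarith
      rw [hx', toRat_roundNE_neg, toRat_roundNE_of_maxRat_le_pos hlt.le, toRat_roundNE_neg, htop]

/-- Exact conversion implies lossless round trip (every pair of formats). -/
theorem roundTrips_of_embeds {φ ψ : Format} (h : Embeds φ ψ) : RoundTrips φ ψ := fun x => by
  rw [toRat_roundNE_of_exists (h x), toRat_roundNE_toRat]

/-- The embedding test implies the round-trip test ((R) ⇒ (R') by saturation). -/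
theorem roundTripTest_of_embedsTest {φ ψ : Format} (ht : embedsTest φ ψ = true) :
    roundTripTest φ ψ = true := by
  simp only [embedsTest, Bool.and_eq_true, decide_eq_true_eq] at ht
  obtain ⟨⟨hm, hq⟩, hM⟩ := ht
  simp only [roundTripTest, Bool.and_eq_true, decide_eq_true_eq]
  exact ⟨⟨hm, hq⟩, by rw [toRat_roundNE_of_maxRat_le_pos ((maxRat_le_maxRat_iff hq).2 hM)]⟩

/-! ## §2 Necessity: three round trips that fail -/

/-- (R') is the round trip of the top value. -/
theorem maxRat_le_roundNE_of_roundTrips {φ ψ : Format} (h : RoundTrips φ ψ) :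
    φ.maxRat ≤ (roundNE φ ψ.maxRat).toRat := by
  rcases le_or_gt φ.maxRat ψ.maxRat with hle | hlt
  · rw [toRat_roundNE_of_maxRat_le_pos hle]
  · have ht := h (top φ)
    rw [toRat_top, toRat_roundNE_of_maxRat_le_pos hlt.le] at ht
    rw [ht]

/-- (Q): the quantum of `X` must survive; if `L_Y > L_X` it goes to `0` in `Y` (below half a
quantum of `Y`, or at half of it with the tie going to the even significand `0`). -/
theorem qexp_le_of_roundTrips {φ ψ : Format} (hψ : 1 ≤ ψ.manBits) (h1 : 1 ≤ φ.maxScaled)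
    (h : RoundTrips φ ψ) : ψ.qexp ≤ φ.qexp := by
  by_contra hlt
  push Not at hlt
  have h2 : (2 : ℚ) ≠ 0 := two_ne_zero
  have hqφ := φ.quantum_pos
  have hqq : 2 * φ.quantum ≤ ψ.quantum := by
    unfold Format.quantum
    calc 2 * (2 : ℚ) ^ φ.qexp = (2 : ℚ) ^ (φ.qexp + 1) := by rw [zpow_add_one₀ h2]; ring
      _ ≤ (2 : ℚ) ^ ψ.qexp := zpow_le_zpow_right₀ (by norm_num) (by omega)
  have ha : (ofScaled φ false 1 h1).toRat = φ.quantum := by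
    rw [toRat_ofScaled_one h1]; rfl
  have hrt := h (ofScaled φ false 1 h1)
  rw [ha] at hrt
  -- w = fl_Y(quantum_X) lies in [0, 2 quantum_X]
  have hw0 : 0 ≤ (roundNE ψ φ.quantum).toRat := by
    have := toRat_roundNE_mono (φ := ψ) hqφ.le
    rwa [toRat_roundNE_zero] at this
  have hnear := roundNE_nearest (φ := ψ) φ.quantum (zero ψ)
  rw [toRat_zero, sub_zero, abs_of_pos hqφ] at hnear
  have hw2 : (roundNE ψ φ.quantum).toRat ≤ 2 * φ.quantum := by
    have := (abs_le.mp hnear).1; linarith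
  -- w = 0: otherwise w = quantum_Y = 2 quantum_X, a tie decided towards the ODD significand
  have hw : (roundNE ψ φ.quantum).toRat = 0 := by
    by_contra hne
    have hpos : (zero ψ).toRat < (roundNE ψ φ.quantum).toRat := by
      rw [toRat_zero]; exact lt_of_le_of_ne hw0 (Ne.symm hne)
    have hsucc := add_ulp_le_of_lt (v := zero ψ) (by rw [toRat_zero]) hpos
    rw [toRat_zero, show (zero ψ).expCode = 0 from rfl] at hsucc
    norm_num at hsucc
    have hwq : (roundNE ψ φ.quantum).toRat = ψ.quantum := by linarith
    have hu : (roundNE ψ φ.quantum).toRat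
        = (zero ψ).toRat + 2 ^ ((zero ψ).expCode - 1) * ψ.quantum := by
      rw [toRat_zero, show (zero ψ).expCode = 0 from rfl]; norm_num; exact hwq
    have hodd := not_two_dvd_man_and_succ hψ (d := zero ψ) (by rw [toRat_zero]) hu
    have heq : |φ.quantum - (zero ψ).toRat| = |φ.quantum - (roundNE ψ φ.quantum).toRat| := by
      rw [toRat_zero, sub_zero, hwq, abs_of_pos hqφ, abs_of_nonpos (by linarith)]; linarith
    have hne' : (zero ψ).toRat ≠ (roundNE ψ φ.quantum).toRat := by
      rw [toRat_zero, hwq]; exact ne_of_lt ψ.quantum_pos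
    have heven := roundNE_man_even_of_tie hψ heq hne'
    exact hodd ⟨dvd_zero 2, heven⟩
  rw [hw, toRat_roundNE_zero] at hrt
  exact absurd hrt (ne_of_lt hqφ)

/-- (P): given (Q), the value `(2^m_X + 1) · 2^(L_X)` goes to `B = 2^m_X · 2^(L_X)` in a format
with fewer significand bits (unique nearest, or the even side of a tie), and `B` comes back as
itself; if `B` exceeds the range of `Y` the top value of `X` already fails. -/
theorem manBits_le_of_roundTrips {φ ψ : Format} (hψ : 1 ≤ ψ.manBits)
    (h2 : 2 ^ (φ.manBits + 1) ≤ φ.maxScaled) (h : RoundTrips φ ψ) : φ.manBits ≤ ψ.manBits := by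
  have hpow1 : 2 ^ φ.manBits ≤ 2 ^ (φ.manBits + 1) := Nat.pow_le_pow_right (by norm_num) (by omega)
  have h1 : 1 ≤ φ.maxScaled := le_trans Nat.one_le_two_pow h2
  have hq := qexp_le_of_roundTrips hψ h1 h
  by_contra hlt
  push Not at hlt
  have htwo : (2 : ℚ) ≠ 0 := two_ne_zero
  have hqφ := φ.quantum_pos
  have hqψ := ψ.quantum_pos
  obtain ⟨d, hd⟩ := Int.eq_ofNat_of_zero_le (sub_nonneg.mpr hq)
  have hquant : φ.quantum = (2 : ℚ) ^ d * ψ.quantum := by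
    unfold Format.quantum
    rw [show φ.qexp = (d : ℤ) + ψ.qexp by omega, zpow_add₀ htwo, zpow_natCast]
  -- the values B = 2^m · quantum_X and A = B + quantum_X of X
  have hm2 : 2 ≤ 2 ^ φ.manBits := by
    calc (2 : ℕ) = 2 ^ 1 := by norm_num
      _ ≤ 2 ^ φ.manBits := Nat.pow_le_pow_right (by norm_num) (by omega)
  have hsucc : 2 ^ (φ.manBits + 1) = 2 * 2 ^ φ.manBits := by rw [pow_succ]; ring
  have hBle : 2 ^ φ.manBits ≤ φ.maxScaled := le_trans hpow1 h2
  have hAle : 2 ^ φ.manBits + 1 ≤ φ.maxScaled := by omega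
  have hAlt : 2 ^ φ.manBits + 1 < 2 ^ (φ.manBits + 1) := by omega
  obtain ⟨B, hBdef⟩ : ∃ B : ℚ, B = (2 : ℚ) ^ φ.manBits * φ.quantum := ⟨_, rfl⟩
  have hB0 : 0 ≤ B := by rw [hBdef]; positivity
  have hBval : (ofScaled φ false (2 ^ φ.manBits) hBle).toRat = B := by
    rw [toRat_ofScaled_of_lt_pow (lt_of_le_of_lt (le_refl _) (Nat.pow_lt_pow_right (by norm_num)
      (by omega))) hBle, hBdef]; unfold Format.quantum; push_cast; ring
  have hAval : (ofScaled φ false (2 ^ φ.manBits + 1) hAle).toRat = B + φ.quantum := by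
    rw [toRat_ofScaled_of_lt_pow hAlt hAle, hBdef]; unfold Format.quantum; push_cast; ring
  have hBexists : ∃ y : MiniFloat φ, y.toRat = B := ⟨_, hBval⟩
  have hBlt : B < φ.maxRat := by
    rw [hBdef]; unfold Format.maxRat
    have : ((2 ^ φ.manBits : ℕ) : ℚ) < (φ.maxScaled : ℚ) := by exact_mod_cast (by omega)
    push_cast at this
    exact mul_lt_mul_of_pos_right this hqφ
  rcases lt_or_ge ψ.maxRat B with hBψ | hBψ
  · -- B beyond the range of Y: the top of X goes to M_Y < B and comes back ≤ B < M_X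
    have ht := h (top φ)
    rw [toRat_top, toRat_roundNE_of_maxRat_le_pos (by linarith : ψ.maxRat ≤ φ.maxRat)] at ht
    have hmono := toRat_roundNE_mono (φ := φ) hBψ.le
    rw [ht, toRat_roundNE_of_exists hBexists] at hmono
    linarith
  · -- B is the value of an explicit datum zB of Y with trailing significand 0
    have hBnat : 2 ^ (φ.manBits + d) ≤ ψ.maxScaled := by
      have h' : ((2 ^ (φ.manBits + d) : ℕ) : ℚ) * ψ.quantum ≤ (ψ.maxScaled : ℚ) * ψ.quantum := by
        rw [hBdef, hquant] at hBψ; unfold Format.maxRat at hBψ; push_cast; rw [pow_add]; linarith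
      exact_mod_cast le_of_mul_le_mul_right h' hqψ
    have hE : φ.manBits + d - ψ.manBits + 1 ≤ ψ.emaxCode := by
      rcases Nat.eq_zero_or_pos ψ.emaxCode with h0 | hpos
      · exfalso
        have ht := ψ.topMan_lt
        rw [← maxScaled_eq_topMan h0] at ht
        have : 2 ^ ψ.manBits ≤ 2 ^ (φ.manBits + d) := Nat.pow_le_pow_right (by norm_num) (by omega)
        omega
      · have hlt' := lt_of_le_of_lt hBnat (maxScaled_lt_pow hpos)
        have := (Nat.pow_lt_pow_iff_right (by norm_num)).1 hlt'
        omega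
    let zB : MiniFloat ψ := ⟨false, φ.manBits + d - ψ.manBits + 1, 0, hE, Nat.two_pow_pos _,
      fun _ => Nat.zero_le _⟩
    have hzBmag : zB.scaledMag = 2 ^ (φ.manBits + d) := by
      show ψ.scaled (φ.manBits + d - ψ.manBits + 1) 0 = _
      unfold Format.scaled
      rw [if_neg (by omega), add_zero, ← pow_add]
      congr 1; omega
    have hzB : zB.toRat = B := by
      have h0 : zB.toInt = (zB.scaledMag : ℤ) := rfl
      rw [toRat_eq_toInt_mul, h0, hzBmag, hBdef, hquant]; push_cast; rw [pow_add]; ring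
    have hulp : (2 : ℚ) ^ (zB.expCode - 1) * ψ.quantum = (2 : ℚ) ^ (φ.manBits - ψ.manBits) * φ.quantum := by
      rw [show zB.expCode - 1 = (φ.manBits - ψ.manBits) + d from by
        show φ.manBits + d - ψ.manBits + 1 - 1 = _; omega, pow_add, hquant]; ring
    have hulp2 : 2 * φ.quantum ≤ (2 : ℚ) ^ (zB.expCode - 1) * ψ.quantum := by
      rw [hulp]
      have : (2 : ℚ) ≤ (2 : ℚ) ^ (φ.manBits - ψ.manBits) := by
        calc (2 : ℚ) = 2 ^ 1 := by norm_num
          _ ≤ 2 ^ (φ.manBits - ψ.manBits) := pow_le_pow_right₀ (by norm_num) (by omega)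
      exact mul_le_mul_of_nonneg_right this hqφ.le
    -- w = fl_Y(A) lies in [B, B + 2 quantum_X]
    have hrt := h (ofScaled φ false (2 ^ φ.manBits + 1) hAle)
    rw [hAval] at hrt
    have hnear := roundNE_nearest (φ := ψ) (B + φ.quantum) zB
    rw [hzB, show B + φ.quantum - B = φ.quantum by ring, abs_of_pos hqφ] at hnear
    obtain ⟨hlo, hhi⟩ := abs_le.mp hnear
    -- w = B: otherwise w = B + ulp_Y(B) = B + 2 quantum_X, a tie decided towards the ODD side
    have hw : (roundNE ψ (B + φ.quantum)).toRat = B := by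
      by_contra hne
      have hpos : zB.toRat < (roundNE ψ (B + φ.quantum)).toRat := by
        rw [hzB]; exact lt_of_le_of_ne (by linarith) (Ne.symm hne)
      have hstep := add_ulp_le_of_lt (v := zB) (by rw [hzB]; exact hB0) hpos
      rw [hzB] at hstep
      have hu : (roundNE ψ (B + φ.quantum)).toRat = zB.toRat + 2 ^ (zB.expCode - 1) * ψ.quantum := by
        rw [hzB]; linarith
      have hodd := not_two_dvd_man_and_succ hψ (d := zB) (by rw [hzB]; exact hB0) hu
      have hwv : (roundNE ψ (B + φ.quantum)).toRat = B + 2 * φ.quantum := by linarith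
      have heq : |B + φ.quantum - zB.toRat| = |B + φ.quantum - (roundNE ψ (B + φ.quantum)).toRat| := by
        rw [hzB, hwv, show B + φ.quantum - B = φ.quantum by ring,
          show B + φ.quantum - (B + 2 * φ.quantum) = -φ.quantum by ring, abs_neg]
      have hne' : zB.toRat ≠ (roundNE ψ (B + φ.quantum)).toRat := by rw [hzB, hwv]; linarith
      have heven := roundNE_man_even_of_tie hψ heq hne'
      exact hodd ⟨dvd_zero 2, heven⟩
    rw [hw, toRat_roundNE_of_exists hBexists] at hrt
    linarith

/-- THEOREM D-rt: for `Y` of precision `≥ 2` and `X` containing `2^(P_X) · 2^(L_X)`, the round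
trip `X → Y → X` is lossless iff the test passes. -/
theorem roundTrips_iff_test {φ ψ : Format} (hψ : 1 ≤ ψ.manBits)
    (h2 : 2 ^ (φ.manBits + 1) ≤ φ.maxScaled) : RoundTrips φ ψ ↔ roundTripTest φ ψ = true := by
  refine ⟨fun h => ?_, roundTrips_of_test⟩
  simp only [roundTripTest, Bool.and_eq_true, decide_eq_true_eq]
  exact ⟨⟨manBits_le_of_roundTrips hψ h2 h,
    qexp_le_of_roundTrips hψ (le_trans Nat.one_le_two_pow h2) h⟩,
    maxRat_le_roundNE_of_roundTrips h⟩

/-- The refuter: a failing test is a value of `X` destroyed by the round trip. -/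
theorem not_roundTrips_of_test {φ ψ : Format} (hψ : 1 ≤ ψ.manBits)
    (h2 : 2 ^ (φ.manBits + 1) ≤ φ.maxScaled) (ht : roundTripTest φ ψ = false) :
    ¬ RoundTrips φ ψ := fun h => by
  have := (roundTrips_iff_test hψ h2).1 h
  rw [ht] at this
  exact Bool.false_ne_true this

/-! ## §3 The phantom top: round trip without embedding -/

/-- Ad-hoc narrow format `{0, 1, 2, 3, 4, 6, 8}` (precision 2, quantum 1, top significand even). -/
def PhantomNarrow : Format := ⟨1, 0, 3, 0, by decide⟩

/-- Ad-hoc wide format `{0, 1/2, …, 7/2, 4, 5, 6, 7}` (precision 3, quantum 1/2, largest value 7,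
one more significand bit and a finer quantum than `PhantomNarrow`, but without the value 8). -/
def PhantomWide : Format := ⟨2, 0, 2, 3, by decide⟩

/-- PHANTOM TOP: `8` is not a value of the wide format, yet `8 ↦ 7 ↦ 8` and every other value is
shared — the round trip is lossless while the conversion is not exact. The range clause (R) of
the embedding test is therefore NOT necessary for round trips; (R') is the right clause. -/
theorem phantom_roundTrips_not_embeds :
    RoundTrips PhantomNarrow PhantomWide ∧ ¬ Embeds PhantomNarrow PhantomWide :=
  ⟨(roundTrips_iff_test (by decide) (by decide)).2 (by decide +kernel),
    not_embeds_of_test (by decide) (by decide)⟩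

/-! ## §4 The named formats: round trip = embedding on all 169 pairs -/

/-- Hypotheses of Theorem D-rt for the named records (precision `≥ 2`, `2^P` a magnitude). -/
theorem rtHyp_of_mem_namedFormats :
    ∀ X ∈ namedFormats, 1 ≤ X.manBits ∧ 2 ^ (X.manBits + 1) ≤ X.maxScaled := by
  decide

/-- NO NAMED PAIR HAS A PHANTOM TOP: on the `13² = 169` ordered pairs of named records the
round-trip test and the embedding test agree (kernel evaluation of both tests). -/
theorem roundTripTest_eq_embedsTest_named :
    ∀ p ∈ namedPairs, roundTripTest p.1 p.2 = embedsTest p.1 p.2 := by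
  decide +kernel

/-- Pair form of `roundTripTest_eq_embedsTest_named`. -/
theorem roundTripTest_eq_embedsTest {X Y : Format} (hX : X ∈ namedFormats)
    (hY : Y ∈ namedFormats) : roundTripTest X Y = embedsTest X Y :=
  roundTripTest_eq_embedsTest_named (X, Y) (mem_namedPairs hX hY)

/-- ROUND TRIP = EXACT CONVERSION for every named pair: `X → Y → X` is lossless iff
`F_X ⊆ F_Y`. -/
theorem roundTrips_named_iff_embeds {X Y : Format} (hX : X ∈ namedFormats)
    (hY : Y ∈ namedFormats) : RoundTrips X Y ↔ Embeds X Y := by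
  rw [roundTrips_iff_test (rtHyp_of_mem_namedFormats Y hY).1 (rtHyp_of_mem_namedFormats X hX).2,
    roundTripTest_eq_embedsTest hX hY, embeds_iff_test (stdOperand_of_mem_namedFormats X hX)]

/-- ROUND-TRIP LATTICE = CONVERSION LATTICE: for named `X`, `Y`, `X → Y → X` is lossless iff
`(X, Y)` is one of the 67 pairs of `embedPairs` (`CONVERSION-LATTICE.md`). -/
theorem roundTrips_named_iff {X Y : Format} (hX : X ∈ namedFormats) (hY : Y ∈ namedFormats) :
    RoundTrips X Y ↔ (X, Y) ∈ embedPairs :=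
  (roundTrips_named_iff_embeds hX hY).trans (embeds_named_iff hX hY)

/-- bfloat16 data do not survive binary16 storage, nor conversely (kernel). -/
example : ¬ RoundTrips BFloat16 Binary16 ∧ ¬ RoundTrips Binary16 BFloat16 :=
  ⟨fun h => absurd ((roundTrips_named_iff (by decide) (by decide)).1 h) (by decide),
    fun h => absurd ((roundTrips_named_iff (by decide) (by decide)).1 h) (by decide)⟩

/-- e4m3 data survive binary16 storage but not fnuz_e4m3 storage (`448 ↦ 240 ↦ 240`); e5m2 data
survive fnuz_e5m2 storage (kernel). -/
example : RoundTrips E4M3 Binary16 ∧ ¬ RoundTrips E4M3 FnuzE4M3 ∧ RoundTrips E5M2 FnuzE5M2 :=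
  ⟨(roundTrips_named_iff (by decide) (by decide)).2 (by decide),
    fun h => absurd ((roundTrips_named_iff (by decide) (by decide)).1 h) (by decide),
    (roundTrips_named_iff (by decide) (by decide)).2 (by decide)⟩

end Summit.Ventures.CertifiedArithmetic
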